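import Summits.ValiantsHypothesis.ValiantsHypothesis.Theorems.FreeSubtorusOrbitDimensionBoundStubPolystableModelBlockSum
import Summits.ValiantsHypothesis.ValiantsHypothesis.Theorems.FreeSubtorusOrbitDimensionBoundStubStableReductionLattice

/-!
# `OrbitDimensionBound` (stmt-ValiantsHypothesis-16133), rung line `filtered_covering` — stub `stub_polystableModel`,
# part 5: every square pencil degenerates to a semisimple one (Jordan–Hölder existence, quotient-free)

Helper file (part 5) for stub 1 `stub_polystableModel` of `Cruxes/OrbitDimensionBound/Lines/filtered_covering.lean`
(route `FreeSubtorus`).  Main result **`exists_semisimple_degeneration`**: for every square polynomial matrix `A` with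
`det A ≠ 0` there are `P, Q ∈ GL_m(ℂ)` and weights `a, b` (`Σ a = Σ b`, `(P A Q) i j = 0` whenever `a i < b j`) such
that the top of the balanced lattice of the TRUNCATION `(P A Q) i j · [a i = b j]` — the limit of the one-parameter
degeneration — is a finite join of atoms (the limit is SEMISIMPLE).  Recursion on the size: either the top is already an
atom (no proper non-zero balanced sub-pencil: `P = Q = 1`, zero weights), or a proper balanced sub-pencil gives a block
upper triangular gauge form; both diagonal blocks degenerate by induction and the two degenerations STACK
(`truncate_stack`), the atoms of the blocks becoming atoms of the block-diagonal limit (`exists_atoms_of_blockDiag`).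

Helper mode (`--supports stmt-ValiantsHypothesis-16133 --as helper`).  Honest framing: [folklore] linear algebra toward
ONE registered stub (`stub_polystableModel`, L) of a dormant rung line; the crux `OrbitDimensionBound`, the route
`FreeSubtorus` and VP ≠ VNP are OPEN and are not moved by this file.

## References (orientation only)
* A. D. King, Quart. J. Math. 45 (1994), §3 (Jordan–Hölder filtrations of `θ`-semistables).
-/

set_option linter.dupNamespace false

namespace Summit.ValiantsHypothesis.ValiantsHypothesis.Theorems.FreeSubtorusOrbitDimensionBound.SquareCovering.StableReduction

open Matrix MvPolynomial Module
open Literature.Computability.AlgebraicComplexity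
open Summit.ValiantsHypothesis.ValiantsHypothesis.Theorems.FreeSubtorusOrbitDimensionBound.SquareCovering
open Summit.ValiantsHypothesis.ValiantsHypothesis.Theorems.FreeSubtorusOrbitDimensionBound.SignCovering.PerSummand

section Graded

variable {σ : Type*} {m d : ℕ}

/-- Block-diagonal invertible matrices along `cornerEquiv`. [folklore] -/
theorem exists_blockGL (hdm : d ≤ m) (P₁ : GL (Fin d) ℂ) (P₂ : GL (Fin (m - d)) ℂ) :
    ∃ G : GL (Fin m) ℂ, (G : Matrix (Fin m) (Fin m) ℂ) =
      Matrix.reindex (cornerEquiv d m hdm) (cornerEquiv d m hdm)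
        (Matrix.fromBlocks (P₁ : Matrix (Fin d) (Fin d) ℂ) 0 0 (P₂ : Matrix (Fin (m - d)) (Fin (m - d)) ℂ)) := by
  have h1 : ∀ (X₁ Y₁ : Matrix (Fin d) (Fin d) ℂ) (X₂ Y₂ : Matrix (Fin (m - d)) (Fin (m - d)) ℂ),
      X₁ * Y₁ = 1 → X₂ * Y₂ = 1 →
      Matrix.reindex (cornerEquiv d m hdm) (cornerEquiv d m hdm) (Matrix.fromBlocks X₁ 0 0 X₂) *
        Matrix.reindex (cornerEquiv d m hdm) (cornerEquiv d m hdm) (Matrix.fromBlocks Y₁ 0 0 Y₂) = 1 := by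
    intro X₁ Y₁ X₂ Y₂ h₁ h₂
    rw [Matrix.reindex_apply, Matrix.reindex_apply, Matrix.submatrix_mul_equiv, Matrix.fromBlocks_multiply]
    simp only [Matrix.mul_zero, Matrix.zero_mul, add_zero, zero_add, h₁, h₂, Matrix.fromBlocks_one,
      Matrix.submatrix_one_equiv]
  refine ⟨⟨_, Matrix.reindex (cornerEquiv d m hdm) (cornerEquiv d m hdm)
      (Matrix.fromBlocks ((P₁⁻¹ : GL (Fin d) ℂ) : Matrix (Fin d) (Fin d) ℂ) 0 0
        ((P₂⁻¹ : GL (Fin (m - d)) ℂ) : Matrix (Fin (m - d)) (Fin (m - d)) ℂ)), h1 _ _ _ _ ?_ ?_, h1 _ _ _ _ ?_ ?_⟩, rfl⟩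
  · rw [← Units.val_mul, mul_inv_cancel, Units.val_one]
  · rw [← Units.val_mul, mul_inv_cancel, Units.val_one]
  · rw [← Units.val_mul, inv_mul_cancel, Units.val_one]
  · rw [← Units.val_mul, inv_mul_cancel, Units.val_one]

/-- The zero corner of a matrix, read in `cornerEquiv` coordinates. [folklore] -/
theorem corner_of_blocks {R : Type*} [Zero R] (hdm : d ≤ m) (Y : Matrix (Fin m) (Fin m) R)
    (h : ∀ (i : Fin (m - d)) (j : Fin d), Y (cornerEquiv d m hdm (Sum.inr i)) (cornerEquiv d m hdm (Sum.inl j)) = 0) :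
    ∀ i j : Fin m, d ≤ (i : ℕ) → (j : ℕ) < d → Y i j = 0 := by
  intro i j hi hj
  have h1 : i = cornerEquiv d m hdm (Sum.inr ⟨i - d, by omega⟩) :=
    Fin.ext (by rw [cornerEquiv_inr_val]; simp; omega)
  have h2 : j = cornerEquiv d m hdm (Sum.inl ⟨j, hj⟩) := Fin.ext (by rw [cornerEquiv_inl_val])
  rw [h1, h2]
  exact h _ _

/-- **Every square pencil degenerates to a semisimple one** (see the module docstring). [folklore] -/
theorem exists_semisimple_degeneration :
    ∀ (m : ℕ) (A : Matrix (Fin m) (Fin m) (MvPolynomial σ ℂ)), A.det ≠ 0 →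
      ∃ (P Q : GL (Fin m) ℂ) (a b : Fin m → ℕ), ∑ i, a i = ∑ j, b j ∧
        (∀ i j, a i < b j →
          ((P : Matrix (Fin m) (Fin m) ℂ).map C * A * (Q : Matrix (Fin m) (Fin m) ℂ).map C :
            Matrix (Fin m) (Fin m) (MvPolynomial σ ℂ)) i j = 0) ∧
        ∃ T : Finset (Submodule ℂ (Fin m → ℂ)),
          (∀ A' ∈ T, A' ≠ ⊥ ∧
            finrank ℂ ↥(⨆ e : σ →₀ ℕ, A'.map (Matrix.toLin' ((Matrix.of fun i j => if a i = b j then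
              ((P : Matrix (Fin m) (Fin m) ℂ).map C * A * (Q : Matrix (Fin m) (Fin m) ℂ).map C :
                Matrix (Fin m) (Fin m) (MvPolynomial σ ℂ)) i j else 0).map (coeff e)))) ≤ finrank ℂ A' ∧
            ∀ A'' : Submodule ℂ (Fin m → ℂ), A'' ≤ A' → A'' ≠ ⊥ →
              finrank ℂ ↥(⨆ e : σ →₀ ℕ, A''.map (Matrix.toLin' ((Matrix.of fun i j => if a i = b j then
                ((P : Matrix (Fin m) (Fin m) ℂ).map C * A * (Q : Matrix (Fin m) (Fin m) ℂ).map C :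
                  Matrix (Fin m) (Fin m) (MvPolynomial σ ℂ)) i j else 0).map (coeff e)))) ≤ finrank ℂ A'' → A'' = A') ∧
          T.sup id = ⊤ := by
  classical
  intro m
  induction m using Nat.strong_induction_on with
  | _ m ih => ?_
  intro A hdet
  set F : (σ →₀ ℕ) → (Fin m → ℂ) →ₗ[ℂ] (Fin m → ℂ) := fun e => Matrix.toLin' (A.map (coeff e)) with hF
  have hss : ∀ V : Submodule ℂ (Fin m → ℂ), finrank ℂ V ≤ finrank ℂ ↥(⨆ e, V.map (F e)) := by
    intro V
    by_contra hlt
    refine hdet (det_eq_zero_of_subpencil A V (⨆ e, V.map (F e)) (fun e x hx => ?_) (not_le.1 hlt))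
    exact Submodule.mem_iSup_of_mem e (Submodule.mem_map_of_mem hx)
  by_cases hsplit : ∃ V : Submodule ℂ (Fin m → ℂ), V ≠ ⊥ ∧ V ≠ ⊤ ∧ finrank ℂ ↥(⨆ e, V.map (F e)) ≤ finrank ℂ V
  swap
  · -- BASE: no proper non-zero balanced sub-pencil — `A` itself is the answer
    push Not at hsplit
    have hA1 : ((1 : GL (Fin m) ℂ) : Matrix (Fin m) (Fin m) ℂ).map C * A * ((1 : GL (Fin m) ℂ) : Matrix (Fin m) (Fin m) ℂ).map C
        = A := by rw [Units.val_one, Matrix.map_one C C_0 C_1, Matrix.one_mul, Matrix.mul_one]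
    have htr : (Matrix.of fun i j => if (fun _ : Fin m => (0 : ℕ)) i = (fun _ : Fin m => (0 : ℕ)) j then
        (((1 : GL (Fin m) ℂ) : Matrix (Fin m) (Fin m) ℂ).map C * A *
          ((1 : GL (Fin m) ℂ) : Matrix (Fin m) (Fin m) ℂ).map C : Matrix (Fin m) (Fin m) (MvPolynomial σ ℂ)) i j else 0) =
        A := by
      rw [hA1]; ext i j; simp
    refine ⟨1, 1, fun _ => 0, fun _ => 0, rfl, fun i j h => (lt_irrefl _ h).elim, ?_⟩
    rw [htr]
    by_cases hm : m = 0
    · subst hm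
      refine ⟨∅, fun A' hA' => (Finset.notMem_empty A' hA').elim, ?_⟩
      rw [Finset.sup_empty]
      exact (Submodule.eq_bot_of_subsingleton).symm
    · refine ⟨{⊤}, fun A' hA' => ?_, by simp⟩
      rw [Finset.mem_singleton] at hA'
      subst hA'
      have htop0 : (⊤ : Submodule ℂ (Fin m → ℂ)) ≠ ⊥ := by
        intro h0
        have := congrArg (fun S : Submodule ℂ (Fin m → ℂ) => finrank ℂ S) h0
        simp only [finrank_top, finrank_bot, finrank_fin_fun] at this
        exact hm this
      refine ⟨htop0, (Submodule.finrank_le _).trans (by rw [finrank_top]), fun V hV hV0 hVbal => ?_⟩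
      by_contra hVtop
      exact absurd hVbal (not_le.2 (hsplit V hV0 hVtop))
  · -- STEP: split along a proper balanced sub-pencil and stack the degenerations of the blocks
    obtain ⟨V, hV0, hVtop, hVbal⟩ := hsplit
    set W : Submodule ℂ (Fin m → ℂ) := ⨆ e, V.map (F e) with hW
    have hd : finrank ℂ W = finrank ℂ V := le_antisymm hVbal (hss V)
    have hdpos : 0 < finrank ℂ V := by rw [pos_iff_ne_zero, Ne, Submodule.finrank_eq_zero]; exact hV0
    have hdlt : finrank ℂ V < m := by have := Submodule.finrank_lt hVtop; rwa [finrank_fin_fun] at this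
    set d := finrank ℂ V with hd_def
    have hdm : d ≤ m := hdlt.le
    obtain ⟨P, Q, hPQ, -, -⟩ := exists_adapted_units V W
    set Bt : Matrix (Fin m) (Fin m) (MvPolynomial σ ℂ) :=
      (P : Matrix (Fin m) (Fin m) ℂ).map C * A * (Q : Matrix (Fin m) (Fin m) ℂ).map C with hBt
    have hcorner : ∀ i j : Fin m, d ≤ (i : ℕ) → (j : ℕ) < d → Bt i j = 0 := by
      intro i j hi hj
      refine apply_eq_zero_of_forall_map_coeff _ i j fun e => ?_
      rw [hBt, map_coeff_mul_map_C, map_coeff_map_C_mul]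
      refine hPQ _ (fun x hx => ?_) i j (by rw [hd]; exact hi) hj
      rw [← Matrix.toLin'_apply]
      exact Submodule.mem_iSup_of_mem e (Submodule.mem_map_of_mem hx)
    set e := cornerEquiv d m hdm with he
    set B₁ := Bt.submatrix (fun i => e (Sum.inl i)) (fun j => e (Sum.inl j)) with hB₁
    set B₂ := Bt.submatrix (fun i => e (Sum.inr i)) (fun j => e (Sum.inr j)) with hB₂
    have hdetBt : Bt.det ≠ 0 := by
      rw [hBt, det_map_C_mul_mul_map_C]
      refine mul_ne_zero ?_ hdet
      rw [Ne, C_eq_zero]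
      exact mul_ne_zero (Matrix.isUnits_det_units P).ne_zero (Matrix.isUnits_det_units Q).ne_zero
    have hdet12 : Bt.det = B₁.det * B₂.det := det_eq_mul_det_of_corner_eq_zero hdm Bt hcorner
    have hdet₁ : B₁.det ≠ 0 := fun h0 => hdetBt (by rw [hdet12, h0, zero_mul])
    have hdet₂ : B₂.det ≠ 0 := fun h0 => hdetBt (by rw [hdet12, h0, mul_zero])
    obtain ⟨P₁, Q₁, a₁, b₁, hs₁, hz₁, T₁, hT₁, hT₁top⟩ := ih d hdlt B₁ hdet₁
    obtain ⟨P₂, Q₂, a₂, b₂, hs₂, hz₂, T₂, hT₂, hT₂top⟩ := ih (m - d) (by omega) B₂ hdet₂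
    obtain ⟨G, hG⟩ := exists_blockGL hdm P₁ P₂
    obtain ⟨H, hH⟩ := exists_blockGL hdm Q₁ Q₂
    -- the assembled gauge form and its blocks
    set Y : Matrix (Fin m) (Fin m) (MvPolynomial σ ℂ) :=
      (G : Matrix (Fin m) (Fin m) ℂ).map C * Bt * (H : Matrix (Fin m) (Fin m) ℂ).map C with hY
    have hGc : ∀ i j : Fin m, d ≤ (i : ℕ) → (j : ℕ) < d → (G : Matrix (Fin m) (Fin m) ℂ) i j = 0 :=
      corner_of_blocks hdm _ fun i j => by rw [hG]; simp [Matrix.reindex_apply]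
    have hHc : ∀ i j : Fin m, d ≤ (i : ℕ) → (j : ℕ) < d → (H : Matrix (Fin m) (Fin m) ℂ) i j = 0 :=
      corner_of_blocks hdm _ fun i j => by rw [hH]; simp [Matrix.reindex_apply]
    have hYc : ∀ i j : Fin m, d ≤ (i : ℕ) → (j : ℕ) < d → Y i j = 0 :=
      corner_mul (corner_mul (corner_map_C hGc) hcorner) (corner_map_C hHc)
    have hG₁ : ((G : Matrix (Fin m) (Fin m) ℂ).map C : Matrix (Fin m) (Fin m) (MvPolynomial σ ℂ)).submatrix
        (fun i => e (Sum.inl i)) (fun j => e (Sum.inl j)) = (P₁ : Matrix (Fin d) (Fin d) ℂ).map C := by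
      ext i j; simp [hG, Matrix.reindex_apply, he]
    have hG₂ : ((G : Matrix (Fin m) (Fin m) ℂ).map C : Matrix (Fin m) (Fin m) (MvPolynomial σ ℂ)).submatrix
        (fun i => e (Sum.inr i)) (fun j => e (Sum.inr j)) = (P₂ : Matrix (Fin (m - d)) (Fin (m - d)) ℂ).map C := by
      ext i j; simp [hG, Matrix.reindex_apply, he]
    have hH₁ : ((H : Matrix (Fin m) (Fin m) ℂ).map C : Matrix (Fin m) (Fin m) (MvPolynomial σ ℂ)).submatrix
        (fun i => e (Sum.inl i)) (fun j => e (Sum.inl j)) = (Q₁ : Matrix (Fin d) (Fin d) ℂ).map C := by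
      ext i j; simp [hH, Matrix.reindex_apply, he]
    have hH₂ : ((H : Matrix (Fin m) (Fin m) ℂ).map C : Matrix (Fin m) (Fin m) (MvPolynomial σ ℂ)).submatrix
        (fun i => e (Sum.inr i)) (fun j => e (Sum.inr j)) = (Q₂ : Matrix (Fin (m - d)) (Fin (m - d)) ℂ).map C := by
      ext i j; simp [hH, Matrix.reindex_apply, he]
    have hY₁ : Y.submatrix (fun i => e (Sum.inl i)) (fun j => e (Sum.inl j)) =
        (P₁ : Matrix (Fin d) (Fin d) ℂ).map C * B₁ * (Q₁ : Matrix (Fin d) (Fin d) ℂ).map C := by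
      rw [hY, he, submatrix_inl_mul hdm _ _ (corner_map_C hHc), submatrix_inl_mul hdm _ _ hcorner, ← he, hG₁, hH₁]
    have hY₂ : Y.submatrix (fun i => e (Sum.inr i)) (fun j => e (Sum.inr j)) =
        (P₂ : Matrix (Fin (m - d)) (Fin (m - d)) ℂ).map C * B₂ * (Q₂ : Matrix (Fin (m - d)) (Fin (m - d)) ℂ).map C := by
      rw [hY, he, submatrix_inr_mul hdm _ _ (corner_mul (corner_map_C hGc) hcorner),
        submatrix_inr_mul hdm _ _ (corner_map_C hGc), ← he, hG₂, hH₂]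
    -- stacked weights
    set K : ℕ := 1 + ∑ i, a₂ i + ∑ j, b₂ j with hK
    have hKa : ∀ i, a₂ i < K := fun i => by
      have := Finset.single_le_sum (fun i _ => Nat.zero_le (a₂ i)) (Finset.mem_univ i); omega
    have hKb : ∀ j, b₂ j < K := fun j => by
      have := Finset.single_le_sum (fun j _ => Nat.zero_le (b₂ j)) (Finset.mem_univ j); omega
    have hz₁' : ∀ i j, a₁ i < b₁ j → Y (e (Sum.inl i)) (e (Sum.inl j)) = 0 := fun i j hij => by
      have := congrFun (congrFun hY₁ i) j
      rw [Matrix.submatrix_apply] at this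
      rw [this]; exact hz₁ i j hij
    have hz₂' : ∀ i j, a₂ i < b₂ j → Y (e (Sum.inr i)) (e (Sum.inr j)) = 0 := fun i j hij => by
      have := congrFun (congrFun hY₂ i) j
      rw [Matrix.submatrix_apply] at this
      rw [this]; exact hz₂ i j hij
    obtain ⟨hs, hz, htr⟩ := truncate_stack hdm Y hYc a₁ b₁ a₂ b₂ hs₁ hs₂ hz₁' hz₂' K hKa hKb
    have hY' : ((G * P : GL (Fin m) ℂ) : Matrix (Fin m) (Fin m) ℂ).map C * A *
        ((Q * H : GL (Fin m) ℂ) : Matrix (Fin m) (Fin m) ℂ).map C = Y := by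
      rw [hY, hBt, Units.val_mul, Units.val_mul, Matrix.map_mul, Matrix.map_mul]
      simp only [Matrix.mul_assoc]
    refine ⟨G * P, Q * H, _, _, hs, fun i j hij => by rw [hY']; exact hz i j hij, ?_⟩
    rw [hY', htr]
    -- the blocks of the truncation are the truncations of the blocks
    have hblk₁ : (Matrix.of fun i j => if a₁ i = b₁ j then Y (e (Sum.inl i)) (e (Sum.inl j)) else 0) =
        Matrix.of fun i j => if a₁ i = b₁ j then ((P₁ : Matrix (Fin d) (Fin d) ℂ).map C * B₁ *
          (Q₁ : Matrix (Fin d) (Fin d) ℂ).map C : Matrix (Fin d) (Fin d) (MvPolynomial σ ℂ)) i j else 0 := by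
      ext i j; simp only [Matrix.of_apply]
      have := congrFun (congrFun hY₁ i) j
      rw [Matrix.submatrix_apply] at this
      rw [this]
    have hblk₂ : (Matrix.of fun i j => if a₂ i = b₂ j then Y (e (Sum.inr i)) (e (Sum.inr j)) else 0) =
        Matrix.of fun i j => if a₂ i = b₂ j then ((P₂ : Matrix (Fin (m - d)) (Fin (m - d)) ℂ).map C * B₂ *
          (Q₂ : Matrix (Fin (m - d)) (Fin (m - d)) ℂ).map C : Matrix (Fin (m - d)) (Fin (m - d)) (MvPolynomial σ ℂ)) i j
          else 0 := by
      ext i j; simp only [Matrix.of_apply]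
      have := congrFun (congrFun hY₂ i) j
      rw [Matrix.submatrix_apply] at this
      rw [this]
    rw [hblk₁, hblk₂]
    exact exists_atoms_of_blockDiag hdm _ _ T₁ hT₁ hT₁top T₂ hT₂ hT₂top

end Graded

end Summit.ValiantsHypothesis.ValiantsHypothesis.Theorems.FreeSubtorusOrbitDimensionBound.SquareCovering.StableReduction
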